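import Literature.MathematicalPhysics.QuantumFieldTheory.Balaban1983to89.B5Hk163Form166
import HarnessLib

/-!
# Route «BalabanUVNodes» (K4 «SpineRates»), node N15 = NE2, -a lane, part 18: THE LAPLACIAN OF BAŁABAN'S MINIMISER IS THE
# BLOCK-CONSTANT EXTENSION OF THE EFFECTIVE ACTION — `(Δ − ∂∂*)·H_k = Q_kᴴ·(H_kᴴ(Δ − ∂∂*)H_k) = n^d·Q_kᴴ·Δ_k` as an identity of
# typed torus operators (the REDUCTION of the fourth (3.42) entry `Δ_UG′` of the vector single-scale piece to the (1.65)∕(1.66) layer)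

Cell `pub-ymgap`, seat `pub-ymgap-dag-n15-a` (KNIT-BY-NAME, generation g4; HUMAN RULING D-0062; chair R424 venue; `bears_on: R4∕N15`).  Filed
`--supports stmt-QuantumFields-19351` (helper).  THEOREMS ONLY; imports the b05∕pv15∕β lineages BY NAME through `B5Hk163Form166` (b2b-balaban-pv16):
`B5Hk163Torus.HkOp`∕`QvOp_mul_HkOp` (`Q_kH_k = 1`, (1.63) + p. 29), `B5Hk163RDiv.DstarD`∕`form_DstarD_HkOp_eq_zero` (`⟨A′, (Δ−∂∂*)H_kB⟩ = 0` on
`N(Q_k)`, p. 29 «which means that …»), `B5Hk163Form166.HkOp_eq_Hk` ((1.63) = (1.103)), `Beta.BlockEffectiveAction.DelK` ((1.65) `Δ_k`),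
`B5Action121.curl_adjoint_curl` ((1.69) on vector fields).  Nothing in the tree is modified; nothing printed is a hypothesis.

WHY (this seat g4, part 17 `…N15VectorPieceReadout`, § «WHAT ENTRY 3 NEEDS»).  The node-vocabulary readout of the vector single-scale piece
`G = H_k·C^{(k)}·(η^{d+1}H_kᵀ)` is landed MODULO its fourth (3.42) entry `Δ_UG′` ([Balaban1985BackgroundPropagators] (3.42) p. 397), taken there as
a displayed binder.  At `U = 1`, in the Landau gauge of [Balaban1984PropagatorsI] Sect. D, the fine-lattice operator whose quadratic form `H_kB`
minimises is `∂*∂ = Δ − ∂∂*` ((1.69); tree `DstarD`, «H_kB is a minimum of ½⟨∂A, ∂A⟩ …» p. 29).  THIS FILE proves that `(Δ − ∂∂*)` applied to the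
minimiser FACTORS THROUGH THE BLOCK AVERAGING: `(Δ − ∂∂*)·H_k = Q_kᴴ·𝕃_k` with `𝕃_k := H_kᴴ·(Δ − ∂∂*)·H_k` — the polarised (1.65) «⟨B, Δ_kB⟩ =
⟨∂H_kB, ∂H_kB⟩», i.e. `𝕃_k = n^d·Δ_k` for the β cell's typed (1.65) operator `DelK` (the factor `n^d = η^{−d}` converts the unweighted adjoint `Q_kᴴ`
into the `⟨·,·⟩_η ∕ ⟨·,·⟩_1`-adjoint `Q_k* = η^{−d}Q_kᴴ`).  CONSEQUENCE for the -a chain: the piece's fourth entry is `(Δ−∂∂*)G = Q_kᴴ·𝕃_k·C^{(k)}·(η^{d+1}H_kᵀ)`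
— a product of the LOCAL block-averaging stencil `Q_kᴴ` ((1.18)) with UNIT-LATTICE operators whose two-lattice η-rates and decay are tree theorems
(`Δ_k`'s (1.66) kernels: `B5Kernel166Decay`, `T4Rate166StripDirect.ksum_rate2_king`, `T4EtaRateSiteTorus.ksum166_step_bound_king`; `C^{(k)}`:
`T4Cov2156Rate`; `H_k`: parts 8∕11) — so NO second-difference estimate of `H_k` is needed (N15-DOSSIER §6 had located the fourth entry as «no
printed∕tree input»; this identity removes that obstruction; the kernel dictionary `𝕃_k ↔ ksum166` and the assembly are the next files).

THE PRINT (text locations; the mathematics below is [folklore] linear algebra over tree theorems).  [Balaban1984PropagatorsI] p. 29: «Using (1.60), or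
better (1.63), we can verify all the properties of H_kB: Q_kH_kB = B, R∂*H_kB = 0, H_kB is a minimum of ½⟨∂A, ∂A⟩ on the hyperplane {A : Q_kA = B,
R∂*A = 0}, which means that ⟨∂A′, ∂H_kB⟩ = 0 on the subspace {A′ : Q_kA′ = 0, R∂*A′ = 0}.» and «The action Δ_k is thus defined by ⟨B, Δ_kB⟩ =
⟨∂H_kB, ∂H_kB⟩. (1.65)»; (1.69) p. 29 «Δ = ∂*∂ + ∂∂*»; (1.50) p. 26 (the Euler–Lagrange equation of the constrained minimum, multiplier `Q_k*ω`).

CONTENTS.  §1 `eq_of_forall_star_single_dotProduct` (vectors are determined by their pairings with the basis), `star_dotProduct_conjTranspose_mulVec`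
(`⟨A′, PᴴX⟩ = ⟨PA′, X⟩`), `QvOp_mulVec_sub_proj` (`A′ − H_kQ_kA′ ∈ N(Q_k)`).  §2 **`DstarD_HkOp_mulVec_eq`** ∕ **`DstarD_mul_HkOp_eq`**:
`(Δ−∂∂*)·H_k = Q_kᴴ·(H_kᴴ·(Δ−∂∂*)·H_k)` (vector and matrix forms).  §3 **`HkOp_conjTranspose_DstarD_HkOp_eq_DelK`**: `H_kᴴ(Δ−∂∂*)H_k = n^d·Δ_k`
(every `a > 0`; `HkOp_eq_Hk`, `curl_adjoint_curl`), hence **`DstarD_mul_HkOp_eq_DelK`**: `(Δ−∂∂*)·H_k = n^d·Q_kᴴ·Δ_k`; `star_dotProduct_DstarD_HkOp`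
(the polarised (1.65): `⟨A′, (Δ−∂∂*)H_kB⟩ = n^d·⟨Q_kA′, Δ_kB⟩` for EVERY fine `A′`).

HONEST FRAMING ∕ LIMITS.  `U = 1` linear theory on the b05 tori `T_η = Π ℤ∕(nM_ν)` (every `n ≥ 1`, every `M`, every `d`); an identity, no estimate;
the Laplacian is the gauge-fixed `Δ − ∂∂*` of Sect. D (on the Landau subspace `{R∂*A = 0}` Bałaban's `Δ_a − aQ*Q` acts as `Δ − ∂∂*`,
`B5Hk163RDiv.DeltaA_mulVec_eq_DstarD_mulVec`), NOT the covariant `Δ_U` of [B9] at `U ≠ 1` (NE2⁺ proper: NOT PRINTED ∕ not proved); count-neutral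
(typed 28∕28 · discharged unchanged); NOT a discharge of N15; one finite T⁴ at fixed ε — NOT infinite volume, NOT OS on ℝ⁴, NOT a mass gap, NOT Clay.
-/

noncomputable section

open scoped BigOperators ComplexConjugate
open Finset Matrix

namespace Summit.QuantumFields.YangMills.BalabanUVNodes.N15.VectorPiece

open Literature.MathematicalPhysics.QuantumFieldTheory.Balaban1983to89
open Literature.MathematicalPhysics.QuantumFieldTheory.Balaban1983to89.B5Prop11Plancherel (Tor fine)
open Literature.MathematicalPhysics.QuantumFieldTheory.Balaban1983to89.B5Action121 (CurlOp curl_adjoint_curl Lap_eq_LapV)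
open Literature.MathematicalPhysics.QuantumFieldTheory.Balaban1983to89.B5Block118 (QvOp)
open Literature.MathematicalPhysics.QuantumFieldTheory.Balaban1983to89.B5Hk163Torus (HkOp QvOp_mul_HkOp)
open Literature.MathematicalPhysics.QuantumFieldTheory.Balaban1983to89.B5Hk163RDiv (DstarD form_DstarD_HkOp_eq_zero)
open Literature.MathematicalPhysics.QuantumFieldTheory.Balaban1983to89.B5Hk163Form166 (HkOp_eq_Hk)
open Literature.MathematicalPhysics.QuantumFieldTheory.Balaban1983to89.Beta.BlockEffectiveAction (DelK)

variable {d : ℕ} (n : ℕ) [NeZero n] (M : Fin d → ℕ) [hM : ∀ μ, NeZero (M μ)]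

/-! ## §1 Linear-algebra plumbing -/

omit [NeZero n] hM in
/-- Two vectors with the same pairings against every basis vector are equal. [folklore] -/
theorem eq_of_forall_star_single_dotProduct {ι : Type} [Fintype ι] [DecidableEq ι] {v w : ι → ℂ}
    (h : ∀ i : ι, star (Pi.single (M := fun _ => ℂ) i 1) ⬝ᵥ v = star (Pi.single (M := fun _ => ℂ) i 1) ⬝ᵥ w) : v = w := by
  funext i
  have hi := h i
  have hs : star (Pi.single (M := fun _ => ℂ) i 1) = Pi.single (M := fun _ => ℂ) i 1 := by
    ext j; by_cases hj : j = i <;> simp [hj]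
  rwa [hs, single_dotProduct, single_dotProduct, one_mul, one_mul] at hi

omit [NeZero n] hM in
/-- `⟨A′, PᴴX⟩ = ⟨PA′, X⟩` (the adjoint for the unweighted Hermitian pairing `star · ⬝ᵥ ·`). [folklore] -/
theorem star_dotProduct_conjTranspose_mulVec {ι κ : Type} [Fintype ι] [Fintype κ] (P : Matrix κ ι ℂ) (A' : ι → ℂ) (X : κ → ℂ) :
    star A' ⬝ᵥ (Pᴴ *ᵥ X) = star (P *ᵥ A') ⬝ᵥ X := by
  rw [star_mulVec, ← dotProduct_mulVec]

/-- `A′ − H_k(Q_kA′)` lies in `N(Q_k)` (by `Q_kH_k = 1`). [cite: Balaban1984PropagatorsI, p.29 («Q_kH_kB = B»)] -/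
theorem QvOp_mulVec_sub_proj (A' : Tor (fine n M) × Fin d → ℂ) :
    QvOp n M *ᵥ (A' - HkOp n M *ᵥ (QvOp n M *ᵥ A')) = 0 := by
  rw [Matrix.mulVec_sub, Matrix.mulVec_mulVec, QvOp_mul_HkOp, Matrix.one_mulVec, sub_self]

/-! ## §2 The Euler–Lagrange identity: `(Δ − ∂∂*)·H_k = Q_kᴴ·(H_kᴴ(Δ − ∂∂*)H_k)` -/

/-- **`(Δ − ∂∂*)H_kB = Q_kᴴ(H_kᴴ(Δ − ∂∂*)H_kB)`** for every unit-lattice 1-form `B`: pair both sides with an arbitrary fine `A′`; the difference is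
`⟨A′ − H_kQ_kA′, (Δ−∂∂*)H_kB⟩ = 0` because `A′ − H_kQ_kA′ ∈ N(Q_k)` («⟨∂A′, ∂H_kB⟩ = 0 on the subspace {A′ : Q_kA′ = 0}»).
[cite: Balaban1984PropagatorsI, p.29 (the minimum property, «which means that …»); (1.50) p.26] -/
theorem DstarD_HkOp_mulVec_eq (B : Tor M × Fin d → ℂ) :
    DstarD n M *ᵥ (HkOp n M *ᵥ B)
      = (QvOp n M)ᴴ *ᵥ ((HkOp n M)ᴴ *ᵥ (DstarD n M *ᵥ (HkOp n M *ᵥ B))) := by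
  classical
  refine eq_of_forall_star_single_dotProduct fun i => ?_
  set A' : Tor (fine n M) × Fin d → ℂ := Pi.single (M := fun _ => ℂ) i 1 with hA'
  rw [star_dotProduct_conjTranspose_mulVec, star_dotProduct_conjTranspose_mulVec, Matrix.mulVec_mulVec]
  -- `⟨A′, X⟩ − ⟨H_kQ_kA′, X⟩ = ⟨A′ − H_kQ_kA′, X⟩ = 0`
  have h0 := form_DstarD_HkOp_eq_zero n M B (A' - HkOp n M *ᵥ (QvOp n M *ᵥ A')) (QvOp_mulVec_sub_proj n M A')
  rw [star_sub, sub_dotProduct, sub_eq_zero, Matrix.mulVec_mulVec] at h0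
  exact h0

/-- Matrix form: **`(Δ − ∂∂*)·H_k = Q_kᴴ·(H_kᴴ·(Δ − ∂∂*)·H_k)`**. [cite: Balaban1984PropagatorsI, p.29; (1.50) p.26] -/
theorem DstarD_mul_HkOp_eq :
    DstarD n M * HkOp n M = (QvOp n M)ᴴ * ((HkOp n M)ᴴ * DstarD n M * HkOp n M) :=
  Matrix.ext_of_mulVec_single fun b => by
    rw [← Matrix.mulVec_mulVec, DstarD_HkOp_mulVec_eq, ← Matrix.mulVec_mulVec, ← Matrix.mulVec_mulVec, ← Matrix.mulVec_mulVec]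

/-! ## §3 Dictionary with the (1.65) operator `Δ_k` -/

/-- `Δ − ∂∂*` IS `½(CurlOp)ᴴCurlOp` ((1.69) on vector fields, `B5Action121.curl_adjoint_curl`). [cite: Balaban1984PropagatorsI, (1.69) p.29, (1.21) p.21] -/
theorem DstarD_eq_half_curl :
    DstarD n M = (1 / 2 : ℂ) • ((CurlOp (fine n M) (n : ℂ))ᴴ * CurlOp (fine n M) (n : ℂ)) := by
  rw [curl_adjoint_curl, ← Lap_eq_LapV, smul_smul]
  norm_num
  rfl

/-- **`H_kᴴ·(Δ − ∂∂*)·H_k = n^d·Δ_k`**: the polarised (1.65) operator IS the β cell's typed `DelK` (any `a > 0`, (1.63) = (1.103) by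
`B5Hk163Form166.HkOp_eq_Hk`) up to the weight `η^d = n^{−d}` of the fine scalar product. [cite: Balaban1984PropagatorsI, (1.65) p.29] -/
theorem HkOp_conjTranspose_DstarD_HkOp_eq_DelK (hn : 1 ≤ n) {a : ℝ} (ha : 0 < a) :
    (HkOp n M)ᴴ * DstarD n M * HkOp n M = ((n : ℂ) ^ d) • DelK n hn M a ha := by
  have hnd : ((n : ℂ) ^ d) ≠ 0 := pow_ne_zero _ (Nat.cast_ne_zero.mpr (NeZero.ne n))
  rw [DelK, smul_smul, mul_inv_cancel₀ hnd, one_smul, ← HkOp_eq_Hk n hn M a ha, DstarD_eq_half_curl]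

/-- **`(Δ − ∂∂*)·H_k = n^d·Q_kᴴ·Δ_k`** — the fourth-entry reduction: the gauge-fixed Laplacian of the minimiser is the (weighted-adjoint) block
averaging applied to the effective action operator of (1.65)∕(1.66). [cite: Balaban1984PropagatorsI, (1.65) p.29, p.29 (minimum property); (1.50) p.26] -/
theorem DstarD_mul_HkOp_eq_DelK (hn : 1 ≤ n) {a : ℝ} (ha : 0 < a) :
    DstarD n M * HkOp n M = ((n : ℂ) ^ d) • ((QvOp n M)ᴴ * DelK n hn M a ha) := by
  rw [DstarD_mul_HkOp_eq, HkOp_conjTranspose_DstarD_HkOp_eq_DelK n M hn ha, Matrix.mul_smul]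

/-- THE POLARISED (1.65): `⟨A′, (Δ − ∂∂*)H_kB⟩ = n^d·⟨Q_kA′, Δ_kB⟩` for EVERY fine 1-form `A′` (not only on `N(Q_k)`, where it is the printed
«⟨∂A′, ∂H_kB⟩ = 0»). [cite: Balaban1984PropagatorsI, (1.65) p.29, p.29 («which means that …»)] -/
theorem star_dotProduct_DstarD_HkOp (hn : 1 ≤ n) {a : ℝ} (ha : 0 < a) (A' : Tor (fine n M) × Fin d → ℂ) (B : Tor M × Fin d → ℂ) :
    star A' ⬝ᵥ (DstarD n M *ᵥ (HkOp n M *ᵥ B)) = ((n : ℂ) ^ d) * (star (QvOp n M *ᵥ A') ⬝ᵥ (DelK n hn M a ha *ᵥ B)) := by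
  rw [Matrix.mulVec_mulVec, DstarD_mul_HkOp_eq_DelK n M hn ha, Matrix.smul_mulVec, dotProduct_smul, ← Matrix.mulVec_mulVec,
    star_dotProduct_conjTranspose_mulVec, smul_eq_mul]

end Summit.QuantumFields.YangMills.BalabanUVNodes.N15.VectorPiece
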